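import Summits.BirchSwinnertonDyer.BirchSwinnertonDyer.Theorems.KatoDescentPotSupersingularKatoFiniteLevelStrictLocalTorsion
import Summits.BirchSwinnertonDyer.Rank1Residual.X11b.LocalPrimaryFinite
import Summits.BirchSwinnertonDyer.Rank1Residual.X11b.LocSurjFromLevels
import Literature.NumberTheory.EllipticCurves.ArchimedeanLocalCondition
import HarnessLib

/-!
# Kato's (14.9.3) at finite level, part 9: `Sel_str^{ur}(K, E[p^∞])` IS FINITE whenever `Sel_{p^∞}(E/K)` is —
# the last hypothesis of the count aligned with the tree's standard `Finite (W.selmerGroupPInfty p)`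
# (route `KatoDescentPotSupersingular` / `…Tame…`, crux M = stmt-BirchSwinnertonDyer-19196; route-free helper)

Seat `bsd-potss-rkm` g17 (prover; cell `bsd-potss`), item stmt-BirchSwinnertonDyer-19196 `ReducibleKatoMember`
(`--supports … --as helper`; closes nothing).  HONEST FRAMING: BSD is not proved by any of this; nothing is booked;
theorems only (no definition, no named fact).

## What

For Kato's strict structure `𝓢∞` on `E[p^∞]` (`X11b.LocBridge.primaryGaloisModule W p`): zero at the places of a finite set
`P ⊇ {v ∣ p}`, UNRAMIFIED at every other finite place, everything at the infinite places; `T ⊇ P` finite with good reduction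
and `p ∉ v` outside `T`; `p` odd.

* `mem_selmerLocalKerPrimary_of_localization_eq_zero` — a class of `H¹(K, E[p^∞])` whose localisation at a `K`-field `E`
  VANISHES satisfies the `p^∞`-Selmer local condition at `E` (it dies in `H¹(Γ_E, E(K̄_E))`); at an infinite place `w` every
  class does, for odd `p` (`2·c` does, `ArchimedeanLocalCondition`, and `c` is `p`-power torsion).
* **`finite_selmerGroup_strict_of_finite_selmerGroupPInfty`** — if `Sel_{p^∞}(E/K) = W.selmerGroupPInfty p` is finite then so is
  `H¹_{𝓢∞}(K, E[p^∞]) = Sel_str^{ur}(K, E[p^∞])`: the map `c ↦ (loc_v c)_{v ∈ T}` lands in the FINITE group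
  `∏_{v ∈ T, v ∉ P} H¹(K_v, E[p^∞])` (X11b `LocalPrimaryFinite`, Tate's local Euler characteristic now a tree theorem) and its
  kernel consists of classes locally trivial at every finite place (`H¹_ur(K_v, E[p^∞]) = 0` at the good `v ∉ T`,
  X11b `unramifiedSubgroup_primary_eq_bot`), hence inside `Sel_{p^∞}(E/K)`.
* **`exists_forall_le_natCard_selmerGroup_relaxed_eq_of_finite_selmerGroupPInfty`** (`K : Type`) and **`…_rat_…`** (`K = ℚ`):
  the counts of parts 6–8 with hypotheses {`Sel_{p^∞}(E/K)` finite, Poitou–Tate family, `T`-data} only: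
  `∃ k₀ ∀ k ≥ k₀: #H¹_ℛ(K,E[p^k]) = #Sel_str^{ur}(K,E[p^∞])·∏_{v∈P}#𝓚_v` (over `ℚ`: `· #E(ℚ_p)[p^k]·p^k`).

References: K. Kato, Astérisque 295 (2004) 14.8, (14.9.3) [Kato2004Asterisque]; R. Greenberg, LNM 1716 §3 Lemma 3.3 [GreenbergLNM1716].
-/

-- the summit and its single problem are both named `BirchSwinnertonDyer` (registry layout D-0017)
set_option linter.dupNamespace false
set_option autoImplicit false

noncomputable section

open scoped Classical ContRepresentation NumberField
open Function Field NumberField IsDedekindDomain WeierstrassCurve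
open Literature.NumberTheory.EllipticCurves Literature.NumberTheory.GaloisRepresentations
  Literature.NumberTheory.GaloisRepresentations.DiscreteGaloisModule Literature.NumberTheory.GaloisCohomology
open Literature.NumberTheory.EllipticCurves.Kato2004
open Summit.BirchSwinnertonDyer.Rank1Residual.X11b.Levels Summit.BirchSwinnertonDyer.Rank1Residual.X11b.LocBridge
open Summit.BirchSwinnertonDyer.Rank1Residual.GaloisImage

universe u

namespace Summit.BirchSwinnertonDyer.BirchSwinnertonDyer.Theorems.KatoFiniteLevelCount

/-! ## §1 Locally trivial classes satisfy the `p^∞`-Selmer condition -/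

section LocalCondition

variable {K : Type u} [Field K] [NumberField K] (W : WeierstrassCurve K) (p : ℕ)

omit [NumberField K] in
/-- **A class of `H¹(K, E[p^∞])` restricting to ZERO in `H¹(Γ_E, E[p^∞])` satisfies the `p^∞`-Selmer local condition at `E`**
(it dies in `H¹(Γ_E, E(K̄_E))`: the restricted cocycle is the coboundary of `a ∈ E[p^∞]`, so after `pointsMap` it is the
coboundary of the point `a`). [cite: SilvermanAEC2009, X.§4 diagram (**)] -/
theorem mem_selmerLocalKerPrimary_of_localization_eq_zero (E : Type u) [Field E] [Algebra K E]
    (c : galoisCohomology (primaryGaloisModule W p) 1)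
    (hc : galoisCohomology.res (primaryGaloisModule W p) E 1 c = 0) :
    c ∈ selmerLocalKerPrimary W E p := by
  obtain ⟨φ, rfl⟩ := oneCocycleClass_surjective (DiscreteGaloisModule.toTopRep (primaryGaloisModule W p)) c
  have hc' := hc
  rw [galoisCohomology.res_oneCocycleClass] at hc'
  obtain ⟨a, ha⟩ := (oneCocycleClass_eq_zero_iff _ _).mp hc'
  refine (oneCocycleClass_mem_resKer_iff (resGal (K := K) E)
    ((pointsMap W E).comp (W.geomPrimaryTorsion p).subtype) _ φ).mpr
    ⟨pointsMap W E ((a : W.geomPrimaryTorsion p) : geomPoints W), fun σ => ?_⟩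
  have h1 : φ.1 (resGal (K := K) E σ) = resGal (K := K) E σ • a - a := by
    rw [WeierstrassCurve.resGal_eq_absGaloisRestrict]; exact ha σ
  change pointsMap W E ((φ.1 (resGal (K := K) E σ) : W.geomPrimaryTorsion p) : geomPoints W) = _
  rw [h1, AddSubgroupClass.coe_sub, map_sub,
    Literature.NumberTheory.EllipticCurves.primaryComponent.coe_smul, pointsMap_smul]

end LocalCondition

section Archimedean

variable {K : Type} [Field K] [NumberField K] (W : WeierstrassCurve K) (p : ℕ) [Fact p.Prime]

/-- **At an infinite place every class of `H¹(K, E[p^∞])` satisfies the `p^∞`-Selmer condition, for odd `p`**: `2 • c` does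
(`two_nsmul_mem_selmerLocalKerPrimary_infinitePlace`), `c` is `p`-power torsion (`Γ_K` compact), and `2` is invertible
modulo `p^N`. [cite: SerreGaloisCohomology1997, I.§2.4 Cor. to Prop. 9] -/
theorem mem_selmerLocalKerPrimary_infinitePlace_of_odd (hodd : p ≠ 2) (w : InfinitePlace K)
    (c : galoisCohomology (primaryGaloisModule W p) 1) : c ∈ selmerLocalKerPrimary W w.Completion p := by
  have hp : p.Prime := Fact.out
  have hB : ∀ Q : W.geomPrimaryTorsion p, ∃ k : ℕ, p ^ k • Q = 0 := fun Q =>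
    (AddCommGroup.mem_primaryComponent.mp Q.2).imp fun k hk =>
      Subtype.ext (by rw [AddSubmonoidClass.coe_nsmul, hk, ZeroMemClass.coe_zero])
  obtain ⟨N, hN⟩ := exists_pow_nsmul_eq_zero_of_primary (primaryGaloisModule W p) hB c
  have h2 := two_nsmul_mem_selmerLocalKerPrimary_infinitePlace W p w c
  rcases Nat.lt_or_ge 1 (p ^ N) with hlt | hle
  · have hcop : Nat.Coprime 2 (p ^ N) :=
      Nat.Coprime.pow_right N ((Nat.coprime_primes Nat.prime_two hp).2 (Ne.symm hodd))
    obtain ⟨m, -, hm⟩ := Nat.exists_mul_mod_eq_one_of_coprime hcop hlt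
    have key : m • (2 • c) = c := by
      calc m • (2 • c) = (2 * m) • c := by rw [smul_smul, mul_comm]
        _ = ((2 * m) % p ^ N + p ^ N * ((2 * m) / p ^ N)) • c := by rw [Nat.mod_add_div]
        _ = c := by rw [hm, add_smul, one_smul, mul_comm (p ^ N), mul_smul, hN, smul_zero, add_zero]
    rw [← key]
    exact AddSubgroup.nsmul_mem _ h2 m
  · have hN1 : p ^ N = 1 := le_antisymm hle (Nat.one_le_iff_ne_zero.2 (pow_ne_zero N hp.ne_zero))
    rw [hN1, one_smul] at hN
    rw [hN]
    exact zero_mem _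

end Archimedean


/-! ## §2 `Sel_str^{ur}(K, E[p^∞])` is finite when `Sel_{p^∞}(E/K)` is -/

section Finite

variable {K : Type} [Field K] [NumberField K] (W : WeierstrassCurve K) [W.IsElliptic] (p : ℕ) [Fact p.Prime]

/-- A class of Kato's strict group that is locally trivial at the places of `T` outside `P` is locally trivial at EVERY
finite place (zero at `P` by the structure; `H¹_ur(K_v, E[p^∞]) = 0` at the good `v ∉ T`, X11b
`unramifiedSubgroup_primary_eq_bot`). [cite: GreenbergLNM1716, §3 Lemma 3.3] -/
theorem localization_eq_zero_of_mem_selmerGroup_strict (P T : Finset (HeightOneSpectrum (𝓞 K)))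
    (hT : ∀ v : HeightOneSpectrum (𝓞 K), v ∉ T → (p : 𝓞 K) ∉ v.asIdeal ∧ W.HasGoodReductionAt v)
    (𝓢inf : SelmerStructure (primaryGaloisModule W p))
    (hIP : ∀ v ∈ P, 𝓢inf (Sum.inr v) = ⊥)
    (hIur : ∀ v ∉ P, 𝓢inf (Sum.inr v) = unramifiedSubgroup (GaloisRep.toLocal v (primaryGaloisModule W p)) 1)
    {c : galoisCohomology (primaryGaloisModule W p) 1} (hc : c ∈ 𝓢inf.selmerGroup)
    (hcT : ∀ v ∈ T, v ∉ P → galoisCohomology.localization (primaryGaloisModule W p) (Sum.inr v) 1 c = 0)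
    (v : HeightOneSpectrum (𝓞 K)) :
    galoisCohomology.localization (primaryGaloisModule W p) (Sum.inr v) 1 c = 0 := by
  have hcS := (SelmerStructure.mem_selmerGroup_iff _ _).mp hc
  by_cases hvP : v ∈ P
  · have h := hcS (Sum.inr v)
    rw [hIP v hvP] at h
    exact (AddSubgroup.mem_bot).mp h
  · by_cases hvT : v ∈ T
    · exact hcT v hvT hvP
    · have h := hcS (Sum.inr v)
      rw [hIur v hvP] at h
      have hbot := unramifiedSubgroup_primary_eq_bot W p (hT v hvT).1 (hT v hvT).2
      have h' : galoisCohomology.localization (primaryGaloisModule W p) (Sum.inr v) 1 c ∈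
          unramifiedSubgroup (GaloisRep.restrictField (v.adicCompletion K) (primaryGaloisModule W p)) 1 := h
      rw [hbot] at h'
      exact (AddSubgroup.mem_bot).mp h'

omit [W.IsElliptic] in
/-- **A class of `H¹(K, E[p^∞])` locally trivial at every finite place lies in `Sel_{p^∞}(E/K)`** (odd `p`; §1).
[cite: Greenberg1999, §2] -/
theorem mem_selmerGroupPInfty_of_forall_localization_eq_zero (hodd : p ≠ 2)
    {c : galoisCohomology (primaryGaloisModule W p) 1}
    (h : ∀ v : HeightOneSpectrum (𝓞 K), galoisCohomology.localization (primaryGaloisModule W p) (Sum.inr v) 1 c = 0) :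
    c ∈ W.selmerGroupPInfty p :=
  AddSubgroup.mem_inf.mpr
    ⟨AddSubgroup.mem_iInf.mpr fun v =>
        mem_selmerLocalKerPrimary_of_localization_eq_zero W p (v.adicCompletion K) c (h v),
      AddSubgroup.mem_iInf.mpr fun w => mem_selmerLocalKerPrimary_infinitePlace_of_odd W p hodd w c⟩

/-- **`Sel_str^{ur}(K, E[p^∞])` is finite whenever `Sel_{p^∞}(E/K)` is.**  `𝓢∞` zero at `P`, unramified at the other finite
places; `T ⊇ P` finite with good reduction and `p ∉ v` outside `T`, `P ⊇ {v ∣ p}`; `p` odd.  The localisation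
`c ↦ (loc_v c)_{v ∈ T, v ∉ P}` has FINITE target (`H¹(K_v, E[p^∞])` finite for `v ∤ p`, X11b
`finite_galoisCohomology_one_primary_toLocal`, Tate's local Euler characteristic a tree theorem) and its kernel is locally trivial
at every finite place, hence inside the finite `Sel_{p^∞}(E/K)`. [cite: GreenbergLNM1716, §3 Lemma 3.3] [cite: Kato2004Asterisque, 14.8 (p. 238)] -/
theorem finite_selmerGroup_strict_of_finite_selmerGroupPInfty (hodd : p ≠ 2) (P T : Finset (HeightOneSpectrum (𝓞 K)))
    (hT : ∀ v : HeightOneSpectrum (𝓞 K), v ∉ T → (p : 𝓞 K) ∉ v.asIdeal ∧ W.HasGoodReductionAt v)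
    (hPp : ∀ v : HeightOneSpectrum (𝓞 K), (p : 𝓞 K) ∈ v.asIdeal → v ∈ P)
    (𝓢inf : SelmerStructure (primaryGaloisModule W p))
    (hIP : ∀ v ∈ P, 𝓢inf (Sum.inr v) = ⊥)
    (hIur : ∀ v ∉ P, 𝓢inf (Sum.inr v) = unramifiedSubgroup (GaloisRep.toLocal v (primaryGaloisModule W p)) 1)
    [Finite (W.selmerGroupPInfty p)] : Finite 𝓢inf.selmerGroup := by
  classical
  -- the finite target: the local groups at `v ∈ T`, `v ∉ P`
  let ι : Type := {v : T // (v : HeightOneSpectrum (𝓞 K)) ∉ P}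
  haveI hfinloc : ∀ v : ι,
      Finite (galoisCohomology ((primaryGaloisModule W p).toLocal (Sum.inr (v.1 : HeightOneSpectrum (𝓞 K)))) 1) := by
    intro v
    haveI : CharZero ((v.1 : HeightOneSpectrum (𝓞 K)).adicCompletion K) := charZero_adicCompletion _
    exact finite_galoisCohomology_one_primary_toLocal W p (v.1 : HeightOneSpectrum (𝓞 K))
      (localEulerPoincareCharacteristic_holds _) (fun h => v.2 (hPp _ h))
  let g : ∀ v : ι, 𝓢inf.selmerGroup →+
      galoisCohomology ((primaryGaloisModule W p).toLocal (Sum.inr (v.1 : HeightOneSpectrum (𝓞 K)))) 1 := fun v =>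
    (galoisCohomology.localization (primaryGaloisModule W p) (Sum.inr (v.1 : HeightOneSpectrum (𝓞 K))) 1).comp
      𝓢inf.selmerGroup.subtype
  let f := AddMonoidHom.pi g
  -- the kernel is locally trivial everywhere, hence inside `Sel_{p^∞}`
  have hker : ∀ c : 𝓢inf.selmerGroup, f c = 0 →
      (c : galoisCohomology (primaryGaloisModule W p) 1) ∈ W.selmerGroupPInfty p := by
    intro c hc
    refine mem_selmerGroupPInfty_of_forall_localization_eq_zero W p hodd
      (localization_eq_zero_of_mem_selmerGroup_strict W p P T hT 𝓢inf hIP hIur c.2 fun v hvT hvP => ?_)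
    have h := congrFun hc ⟨⟨v, hvT⟩, hvP⟩
    simpa [f, g] using h
  -- the kernel is finite (it embeds into `Sel_{p^∞}`), the target is finite
  haveI : Finite f.ker :=
    Finite.of_injective
      (fun c : f.ker => (⟨((c : 𝓢inf.selmerGroup) : galoisCohomology (primaryGaloisModule W p) 1),
        hker (c : 𝓢inf.selmerGroup) ((AddMonoidHom.mem_ker).1 c.2)⟩ : W.selmerGroupPInfty p))
      fun a b h => by
        apply Subtype.ext
        apply Subtype.ext
        have h' := congrArg (fun x : W.selmerGroupPInfty p => (x : W.galH1Primary p)) h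
        exact h'
  haveI : Fintype f.ker := Fintype.ofFinite _
  haveI : Fintype (∀ v : ι, galoisCohomology ((primaryGaloisModule W p).toLocal
      (Sum.inr (v.1 : HeightOneSpectrum (𝓞 K)))) 1) := Fintype.ofFinite _
  exact (AddGroup.fintypeOfKerOfCodom f).finite

/-- **The count with `Sel_{p^∞}(E/K)` finite as the ONLY arithmetic hypothesis** (`K : Type`): `∃ k₀ ∀ k ≥ k₀`, for every
Poitou–Tate family at level `p^k` and every Kato pair `𝓢 ≤ ℛ` on `E[p^k]`,
`#H¹_ℛ(K, E[p^k]) = #Sel_str^{ur}(K, E[p^∞]) · ∏_{v∈P} #𝓚_v`. [cite: Kato2004Asterisque, (14.9.3)–(14.9.4) (p. 240) and Prop. 14.16 (p. 244)] -/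
theorem exists_forall_le_natCard_selmerGroup_relaxed_eq_of_finite_selmerGroupPInfty {K : Type} [Field K]
    [NumberField K] (W : WeierstrassCurve K) [W.IsElliptic] (p : ℕ) [Fact p.Prime] (hodd : p ≠ 2)
    (P T : Finset (HeightOneSpectrum (𝓞 K)))
    (hPT : P ⊆ T) (hT : ∀ v : HeightOneSpectrum (𝓞 K), v ∉ T → (p : 𝓞 K) ∉ v.asIdeal ∧ W.HasGoodReductionAt v)
    (hPp : ∀ v : HeightOneSpectrum (𝓞 K), (p : 𝓞 K) ∈ v.asIdeal → v ∈ P)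
    (𝓢inf : SelmerStructure (primaryGaloisModule W p)) [Finite (W.selmerGroupPInfty p)]
    (hIP : ∀ v ∈ P, 𝓢inf (Sum.inr v) = ⊥)
    (hIur : ∀ v ∉ P, 𝓢inf (Sum.inr v) = unramifiedSubgroup (GaloisRep.toLocal v (primaryGaloisModule W p)) 1)
    (hIinl : ∀ w : InfinitePlace K, 𝓢inf (Sum.inl w) = ⊤) {v₀ : HeightOneSpectrum (𝓞 K)} (hv₀P : v₀ ∈ P) :
    ∃ k₀ : ℕ, ∀ k, k₀ ≤ k →
      ∀ (inv : LocalInvariants K (p ^ k)), inv.IsPerfect → inv.SumLocalTermEqZero → inv.SelmerComplement →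
      ∀ (𝓢 ℛ : SelmerStructure (W.torsionGaloisModule ((p ^ k : ℕ) : ℤ))),
        (∀ v ∈ P, 𝓢 (Sum.inr v) = ⊥) → (∀ v ∈ P, ℛ (Sum.inr v) = ⊤) →
        (∀ v ∉ P, 𝓢 (Sum.inr v) = unramifiedSubgroup (GaloisRep.toLocal v (W.torsionGaloisModule ((p ^ k : ℕ) : ℤ))) 1) →
        (∀ v ∉ P, ℛ (Sum.inr v) = unramifiedSubgroup (GaloisRep.toLocal v (W.torsionGaloisModule ((p ^ k : ℕ) : ℤ))) 1) →
        Nat.card ℛ.selmerGroup =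
          Nat.card 𝓢inf.selmerGroup * ∏ v ∈ P, Nat.card (W.kummerSelmerStructure ((p ^ k : ℕ) : ℤ) (Sum.inr v)) := by
  haveI := finite_selmerGroup_strict_of_finite_selmerGroupPInfty W p hodd P T hT hPp 𝓢inf hIP hIur
  exact exists_forall_le_natCard_selmerGroup_relaxed_eq' W p hodd P T hPT hT hPp 𝓢inf hIP hIur hIinl hv₀P

/-- **Over `ℚ`, with `Sel_{p^∞}(E/ℚ)` finite as the only arithmetic hypothesis**: `∃ k₀ ∀ k ≥ k₀`, for every Poitou–Tate family
at level `p^k` and every Kato pair `𝓢 ≤ ℛ` on `E[p^k]` (zero / everything at `v_p`, unramified at every other prime),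
**`#H¹_ℛ(ℚ,E[p^k]) = #Sel_str^{ur}(ℚ,E[p^∞]) · #E(ℚ_{v_p})[p^k] · p^k`**. [cite: Kato2004Asterisque, (14.9.3)–(14.9.4) (p. 240) and Prop. 14.16 (p. 244)] -/
theorem exists_forall_le_natCard_selmerGroup_relaxed_eq_rat_of_finite_selmerGroupPInfty (W : WeierstrassCurve ℚ)
    [W.IsElliptic] (p : ℕ) [Fact p.Prime] (hodd : p ≠ 2)
    (T : Finset (HeightOneSpectrum (𝓞 ℚ))) (hpT : primePlace p ∈ T)
    (hT : ∀ v : HeightOneSpectrum (𝓞 ℚ), v ∉ T → W.HasGoodReductionAt v)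
    (𝓢inf : SelmerStructure (primaryGaloisModule W p)) [Finite (W.selmerGroupPInfty p)]
    (hIP : 𝓢inf (Sum.inr (primePlace p)) = ⊥)
    (hIur : ∀ v : HeightOneSpectrum (𝓞 ℚ), v ≠ primePlace p →
      𝓢inf (Sum.inr v) = unramifiedSubgroup (GaloisRep.toLocal v (primaryGaloisModule W p)) 1)
    (hIinl : ∀ w : InfinitePlace ℚ, 𝓢inf (Sum.inl w) = ⊤) :
    ∃ k₀ : ℕ, ∀ k, k₀ ≤ k →
      ∀ (inv : LocalInvariants ℚ (p ^ k)), inv.IsPerfect → inv.SumLocalTermEqZero → inv.SelmerComplement →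
      ∀ (𝓢 ℛ : SelmerStructure (W.torsionGaloisModule ((p ^ k : ℕ) : ℤ))),
        𝓢 (Sum.inr (primePlace p)) = ⊥ → ℛ (Sum.inr (primePlace p)) = ⊤ →
        (∀ v : HeightOneSpectrum (𝓞 ℚ), v ≠ primePlace p →
          𝓢 (Sum.inr v) = unramifiedSubgroup (GaloisRep.toLocal v (W.torsionGaloisModule ((p ^ k : ℕ) : ℤ))) 1) →
        (∀ v : HeightOneSpectrum (𝓞 ℚ), v ≠ primePlace p →
          ℛ (Sum.inr v) = unramifiedSubgroup (GaloisRep.toLocal v (W.torsionGaloisModule ((p ^ k : ℕ) : ℤ))) 1) →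
        Nat.card ℛ.selmerGroup =
          Nat.card 𝓢inf.selmerGroup *
            (Nat.card (nsmulAddMonoidHom (p ^ k) :
              (W.baseChange ((primePlace p).adicCompletion ℚ)).toAffine.Point →+ _).ker * p ^ k) := by
  haveI : Finite 𝓢inf.selmerGroup :=
    finite_selmerGroup_strict_of_finite_selmerGroupPInfty W p hodd {primePlace p} T
      (fun v hv => ⟨natCast_not_mem_of_ne_primePlace p (fun h => hv (h ▸ hpT)), hT v hv⟩)
      (fun v hv => Finset.mem_singleton.2 (eq_primePlace_of_natCast_mem p hv)) 𝓢inf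
      (fun v hv => by rw [Finset.mem_singleton.1 hv]; exact hIP)
      (fun v hv => hIur v (fun h => hv (Finset.mem_singleton.2 h)))
  exact exists_forall_le_natCard_selmerGroup_relaxed_eq_rat' p W hodd T hpT hT 𝓢inf hIP hIur hIinl

end Finite

end Summit.BirchSwinnertonDyer.BirchSwinnertonDyer.Theorems.KatoFiniteLevelCount

end
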